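/-
COR-CM (cell pub-hodgecm2, stage 2 of the Hodge ladder) — count-neutral KERNEL COMBINATORICS «the sheared dihedral family», part XVIII: the closing family
`B1` of the slice column and its spanning trees (seat prover-pub-hodgecm2-b23-g52-0, binder prover b23, gen 52; claim «SYLOW TRANSFER XII + THE SHEARED
DIHEDRAL FAMILY», HOME/INBOX.md l.23708).  PORT of gen 44ʼs `Census/QuarticInversionTrees.lean` (this lineage) to the motion of the involution `s`
(mask `bS = {1,3}`, parts VI/XI/XII; gen 44ʼs parts IX–XVII BY NAME for `sqFace`, `mixFace`, `binVec`, `memT/memS/memJ`, `qY_pY`) at square class `ζ = 0` (the only class of the sheared dihedral groups `X_n`): bookkeeping definitions with bodies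
(`faceListS`, `famB1S`) + theorems; `decide` only on closed identities of `Bool`/`Fin 4`/`Fin 4 → Bool` literals, no certificate, no named fact, no
geometry, no `sorry`.  The chains of §3 were found by a breadth-first search (this folderʼs `work/gen52/trees_s.py`, adapted from gen 44ʼs
`trees.py`) and are checked here by the kernel.  `Interfaces.lean` (C1), every E term, B01, `Transposition/*`, `PortJoin/*`, `D2Bridge/*` untouched.
HONEST FRAMING: `HC_CM` is NOT proved, here or anywhere in the tree; nothing here is a period, a count of record or a headline.
-/
import Summits.HodgeConjecture.CorCM.Census.ShearedDihedralOrbit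
import Summits.HodgeConjecture.CorCM.Census.QuarticInversionTrees

/-!
# The sheared dihedral family, XVIII: the closing family `B1` and the spanning trees of the slice column

CONTENT (`|A|` odd `≥ 3`, square class `0`; a slot datum `(P, u₁, u₂ ; Q, w, u₀)` with `|P| + 1 = K`, `u₁ ≠ u₂ ∉ P`, `|Q| = K`, `w ∉ Q`, and a
cross datum `(σ, s₀)` for `P⁺ = P ∪ {u₁, u₂}` as in gen 44ʼs part XVI).
* §1 **The closing family `B1`** (the same ten faces as gen 44ʼs): the equator-crossing squares `S_b`, `b ∈ {TTT, FFF, TTF, FFT, TFT}`, and the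
  mixed faces `M(1;TTT), M(2;TTT), M(1;TFT), M(1;TFF), M(1;TTF)` (gen 44 `sqFace`, `mixFace`).
* §2–§3 **Edges and the spanning tree at the atom coordinate `1`** for the value module `valModS A 0 B1` of part XII (moves by `y` unmasked at
  `ζ = 0`, the move `3 → 1` by `s` MASKED — `S_mem'` of part XII): every slot binomial of coordinate `1` lies in the value module (`toRoot_oneS`,
  `all_oneS`).
* §4 Moving by `y` (`1 → 0`, `3 → 2`, unmasked) and by `s` (`1 → 3`, masked: patterns complemented-and-swapped by `qS`, still exhaustive): EVERY slot
  binomial lies in the value module (`all_binS`).  All [folklore].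

## References
* [Pohlmann1968] H. Pohlmann, Algebraic cycles on abelian varieties of complex multiplication type, Ann. of Math. 88 (1968), Thm 1.
-/

namespace Summit.HodgeConjecture.CorCM.Census.ShearedDihedral

open Summit.HodgeConjecture.CorCM.Census.QuarticInversion
open Finset
open Summit.HodgeConjecture.CorCM.Census.OddSliceFacesModel

noncomputable section

variable (A : Type) [AddCommGroup A] [Fintype A] [DecidableEq A]

/-! ## §1 The closing family `B1` -/

/-- **The ten closing faces** (in a slot datum `(P, u₁, u₂ ; Q, w, u₀)`); the same list as gen 44ʼs `faceList`. [folklore] -/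
def faceListS (P : Finset A) (u₁ u₂ : A) (Q : Finset A) (w u₀ : A) : Fin 10 → (Ty₄ A → ℤ) :=
  ![sqFace A P u₁ u₂ ![false, true, true, true], sqFace A P u₁ u₂ ![true, false, false, false],
    sqFace A P u₁ u₂ ![false, true, true, false], sqFace A P u₁ u₂ ![true, false, false, true],
    sqFace A P u₁ u₂ ![false, true, false, true],
    mixFace A Q w 1 u₀ ![false, true, true, true], mixFace A Q w 2 u₀ ![false, true, true, true],
    mixFace A Q w 1 u₀ ![false, true, false, true], mixFace A Q w 1 u₀ ![false, true, false, false],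
    mixFace A Q w 1 u₀ ![false, true, true, false]]

/-- **The closing family `B1`** of the slice column as a finite set. [folklore] -/
def famB1S (P : Finset A) (u₁ u₂ : A) (Q : Finset A) (w u₀ : A) : Finset (Ty₄ A → ℤ) := univ.image (faceListS A P u₁ u₂ Q w u₀)

omit [AddCommGroup A] in
/-- `B1` has at most ten members. [folklore] -/
theorem card_famB1S_le (P : Finset A) (u₁ u₂ : A) (Q : Finset A) (w u₀ : A) : (famB1S A P u₁ u₂ Q w u₀).card ≤ 10 :=
  (Finset.card_image_le).trans (by simp)

section Members
variable (P : Finset A) (u₁ u₂ : A) (Q : Finset A) (w u₀ : A)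

omit [AddCommGroup A]

/-- Listed faces belong to `B1`. [folklore] -/
theorem faceListS_mem (k : Fin 10) : faceListS A P u₁ u₂ Q w u₀ k ∈ (↑(famB1S A P u₁ u₂ Q w u₀) : Set (Ty₄ A → ℤ)) :=
  Finset.mem_coe.mpr (Finset.mem_image_of_mem _ (Finset.mem_univ k))

/-- `S_TTT ∈ B1`. [folklore] -/
theorem mem_S_TTT : sqFace A P u₁ u₂ ![false, true, true, true] ∈ (↑(famB1S A P u₁ u₂ Q w u₀) : Set (Ty₄ A → ℤ)) :=
  faceListS_mem A P u₁ u₂ Q w u₀ 0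
/-- `S_FFF ∈ B1` (as the complement of `TTT`). [folklore] -/
theorem mem_S_FFF : sqFace A P u₁ u₂ (fun n => !(![false, true, true, true] : Fin 4 → Bool) n) ∈
    (↑(famB1S A P u₁ u₂ Q w u₀) : Set (Ty₄ A → ℤ)) := by
  have e : (fun n => !(![false, true, true, true] : Fin 4 → Bool) n) = ![true, false, false, false] := by decide
  rw [e]; exact faceListS_mem A P u₁ u₂ Q w u₀ 1
/-- `S_TTF ∈ B1`. [folklore] -/
theorem mem_S_TTF : sqFace A P u₁ u₂ ![false, true, true, false] ∈ (↑(famB1S A P u₁ u₂ Q w u₀) : Set (Ty₄ A → ℤ)) :=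
  faceListS_mem A P u₁ u₂ Q w u₀ 2
/-- `S_FFT ∈ B1` (as the complement of `TTF`). [folklore] -/
theorem mem_S_FFT : sqFace A P u₁ u₂ (fun n => !(![false, true, true, false] : Fin 4 → Bool) n) ∈
    (↑(famB1S A P u₁ u₂ Q w u₀) : Set (Ty₄ A → ℤ)) := by
  have e : (fun n => !(![false, true, true, false] : Fin 4 → Bool) n) = ![true, false, false, true] := by decide
  rw [e]; exact faceListS_mem A P u₁ u₂ Q w u₀ 3
/-- `S_TFT ∈ B1`. [folklore] -/
theorem mem_S_TFT : sqFace A P u₁ u₂ ![false, true, false, true] ∈ (↑(famB1S A P u₁ u₂ Q w u₀) : Set (Ty₄ A → ℤ)) :=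
  faceListS_mem A P u₁ u₂ Q w u₀ 4
/-- `M(1;TTT) ∈ B1`. [folklore] -/
theorem mem_M1_TTT : mixFace A Q w 1 u₀ ![false, true, true, true] ∈ (↑(famB1S A P u₁ u₂ Q w u₀) : Set (Ty₄ A → ℤ)) :=
  faceListS_mem A P u₁ u₂ Q w u₀ 5
/-- `M(2;TTT) ∈ B1`. [folklore] -/
theorem mem_M2_TTT : mixFace A Q w 2 u₀ ![false, true, true, true] ∈ (↑(famB1S A P u₁ u₂ Q w u₀) : Set (Ty₄ A → ℤ)) :=
  faceListS_mem A P u₁ u₂ Q w u₀ 6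
/-- `M(1;TFT) ∈ B1`. [folklore] -/
theorem mem_M1_TFT : mixFace A Q w 1 u₀ ![false, true, false, true] ∈ (↑(famB1S A P u₁ u₂ Q w u₀) : Set (Ty₄ A → ℤ)) :=
  faceListS_mem A P u₁ u₂ Q w u₀ 7
/-- `M(1;TFF) ∈ B1`. [folklore] -/
theorem mem_M1_TFF : mixFace A Q w 1 u₀ ![false, true, false, false] ∈ (↑(famB1S A P u₁ u₂ Q w u₀) : Set (Ty₄ A → ℤ)) :=
  faceListS_mem A P u₁ u₂ Q w u₀ 8
/-- `M(1;TTF) ∈ B1`. [folklore] -/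
theorem mem_M1_TTF : mixFace A Q w 1 u₀ ![false, true, true, false] ∈ (↑(famB1S A P u₁ u₂ Q w u₀) : Set (Ty₄ A → ℤ)) :=
  faceListS_mem A P u₁ u₂ Q w u₀ 9

end Members

/-! ## §2–§3 Edges and spanning trees at the atom coordinate `1` -/

section Trees
variable {P : Finset A} {u₁ u₂ : A} {Q : Finset A} {w u₀ σ s₀ : A}

/-- **Every pattern is joined to the root at coordinate `1`** (square class `0`): for every pattern `a` and slot `u`, `binVec 1 a FFFF u` lies in
the value module of `B1`. [folklore] -/
theorem toRoot_oneS (hA : Odd (Fintype.card A)) (h3 : 3 ≤ Fintype.card A) (h1 : u₁ ∉ P) (h2 : u₂ ∉ P) (h12 : u₁ ≠ u₂)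
    (hP : P.card + 1 = Fintype.card A / 2) (hs₀ : s₀ ∈ insert u₁ (insert u₂ P))
    (hX : ∀ s, s + σ ∈ insert u₁ (insert u₂ P) ↔ (s ∉ insert u₁ (insert u₂ P) ∨ s = s₀)) (hw : w ∉ Q)
    (hQ : Q.card = Fintype.card A / 2) (a : Fin 4 → Bool) (u : A) :
    binVec A 1 a ![false, false, false, false] u ∈ valModS A 0 ↑(famB1S A P u₁ u₂ Q w u₀) := by
  have ea : a = ![a 0, a 1, a 2, a 3] := by funext n; fin_cases n <;> rfl
  rw [ea]
  have key : ∀ a0 a1 a2 a3 : Bool,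
      binVec A 1 ![a0, a1, a2, a3] ![false, false, false, false] u ∈ valModS A 0 ↑(famB1S A P u₁ u₂ Q w u₀) := by
    intro a0 a1 a2 a3
    have m1 : binVec A 1 ![false, false, false, false] ![true, false, false, false] u ∈ valModS A 0 ↑(famB1S A P u₁ u₂ Q w u₀) :=
      mix_memS A hA h3 hw hQ (i := 1) (by decide) (b := ![false, true, true, true]) (by decide) (mem_M1_TTT A P u₁ u₂ Q w u₀) (by decide) (by decide) u
    have m2 : binVec A 2 ![false, false, false, false] ![true, false, false, false] u ∈ valModS A 0 ↑(famB1S A P u₁ u₂ Q w u₀) :=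
      mix_memS A hA h3 hw hQ (i := 2) (by decide) (b := ![false, true, true, true]) (by decide) (mem_M2_TTT A P u₁ u₂ Q w u₀) (by decide) (by decide) u
    have m3 : binVec A 1 ![false, false, true, false] ![true, false, true, false] u ∈ valModS A 0 ↑(famB1S A P u₁ u₂ Q w u₀) :=
      mix_memS A hA h3 hw hQ (i := 1) (by decide) (b := ![false, true, false, true]) (by decide) (mem_M1_TFT A P u₁ u₂ Q w u₀) (by decide) (by decide) u
    have m4 : binVec A 1 ![false, false, true, true] ![true, false, true, true] u ∈ valModS A 0 ↑(famB1S A P u₁ u₂ Q w u₀) :=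
      mix_memS A hA h3 hw hQ (i := 1) (by decide) (b := ![false, true, false, false]) (by decide) (mem_M1_TFF A P u₁ u₂ Q w u₀) (by decide) (by decide) u
    have m5 : binVec A 1 ![false, false, false, true] ![true, false, false, true] u ∈ valModS A 0 ↑(famB1S A P u₁ u₂ Q w u₀) :=
      mix_memS A hA h3 hw hQ (i := 1) (by decide) (b := ![false, true, true, false]) (by decide) (mem_M1_TTF A P u₁ u₂ Q w u₀) (by decide) (by decide) u
    have x6 : binVec A 0 ![true, false, false, false] ![false, true, true, true] u ∈ valModS A 0 ↑(famB1S A P u₁ u₂ Q w u₀) :=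
      cross_memS A hA h1 h2 h12 hP hs₀ hX (b := ![false, true, true, true]) (mem_S_TTT A P u₁ u₂ Q w u₀) (mem_S_FFF A P u₁ u₂ Q w u₀) (by decide) u
    have x7 : binVec A 0 ![true, false, false, true] ![false, true, true, false] u ∈ valModS A 0 ↑(famB1S A P u₁ u₂ Q w u₀) :=
      cross_memS A hA h1 h2 h12 hP hs₀ hX (b := ![false, true, true, false]) (mem_S_TTF A P u₁ u₂ Q w u₀) (mem_S_FFT A P u₁ u₂ Q w u₀) (by decide) u
    have y8 : binVec A 1 ![false, true, false, false] ![true, false, true, true] u ∈ valModS A 0 ↑(famB1S A P u₁ u₂ Q w u₀) :=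
      Y_memS A hA (j := 0) (by decide) (by decide) (by decide) (by decide) x6 u
    have y9 : binVec A 1 ![false, true, true, false] ![true, false, false, true] u ∈ valModS A 0 ↑(famB1S A P u₁ u₂ Q w u₀) :=
      Y_memS A hA (j := 0) (by decide) (by decide) (by decide) (by decide) x7 u
    have y10 : binVec A 3 ![false, false, false, false] ![false, true, false, false] u ∈ valModS A 0 ↑(famB1S A P u₁ u₂ Q w u₀) :=
      Y_memS A hA (j := 2) (by decide) (by decide) (by decide) (by decide) m2 u
    have t11 : binVec A 1 ![true, false, true, true] ![true, false, true, false] u ∈ valModS A 0 ↑(famB1S A P u₁ u₂ Q w u₀) :=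
      S_mem' A hA (j := 3) (by decide) (by decide) (by decide) (by decide) y10 u
    have c0000 : binVec A 1 ![false, false, false, false] ![false, false, false, false] u ∈ valModS A 0 ↑(famB1S A P u₁ u₂ Q w u₀) :=
      memJ A _ (a := ![false, false, false, false]) (b := ![false, false, false, false]) (fun _ _ => rfl) u
    have c1000 : binVec A 1 ![true, false, false, false] ![false, false, false, false] u ∈ valModS A 0 ↑(famB1S A P u₁ u₂ Q w u₀) :=
      memT A (memS A m1) c0000
    have c0100 : binVec A 1 ![false, true, false, false] ![false, false, false, false] u ∈ valModS A 0 ↑(famB1S A P u₁ u₂ Q w u₀) :=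
      memT A (memJ A _ (a := ![false, true, false, false]) (b := ![false, false, false, false]) (by decide) u) c0000
    have c1100 : binVec A 1 ![true, true, false, false] ![false, false, false, false] u ∈ valModS A 0 ↑(famB1S A P u₁ u₂ Q w u₀) :=
      memT A (memJ A _ (a := ![true, true, false, false]) (b := ![true, false, false, false]) (by decide) u) c1000
    have c1011 : binVec A 1 ![true, false, true, true] ![false, false, false, false] u ∈ valModS A 0 ↑(famB1S A P u₁ u₂ Q w u₀) :=
      memT A (memS A y8) c0100
    have c0011 : binVec A 1 ![false, false, true, true] ![false, false, false, false] u ∈ valModS A 0 ↑(famB1S A P u₁ u₂ Q w u₀) :=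
      memT A m4 c1011
    have c1010 : binVec A 1 ![true, false, true, false] ![false, false, false, false] u ∈ valModS A 0 ↑(famB1S A P u₁ u₂ Q w u₀) :=
      memT A (memS A t11) c1011
    have c1111 : binVec A 1 ![true, true, true, true] ![false, false, false, false] u ∈ valModS A 0 ↑(famB1S A P u₁ u₂ Q w u₀) :=
      memT A (memJ A _ (a := ![true, true, true, true]) (b := ![true, false, true, true]) (by decide) u) c1011
    have c0111 : binVec A 1 ![false, true, true, true] ![false, false, false, false] u ∈ valModS A 0 ↑(famB1S A P u₁ u₂ Q w u₀) :=
      memT A (memJ A _ (a := ![false, true, true, true]) (b := ![false, false, true, true]) (by decide) u) c0011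
    have c0010 : binVec A 1 ![false, false, true, false] ![false, false, false, false] u ∈ valModS A 0 ↑(famB1S A P u₁ u₂ Q w u₀) :=
      memT A m3 c1010
    have c1110 : binVec A 1 ![true, true, true, false] ![false, false, false, false] u ∈ valModS A 0 ↑(famB1S A P u₁ u₂ Q w u₀) :=
      memT A (memJ A _ (a := ![true, true, true, false]) (b := ![true, false, true, false]) (by decide) u) c1010
    have c0110 : binVec A 1 ![false, true, true, false] ![false, false, false, false] u ∈ valModS A 0 ↑(famB1S A P u₁ u₂ Q w u₀) :=
      memT A (memJ A _ (a := ![false, true, true, false]) (b := ![false, false, true, false]) (by decide) u) c0010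
    have c1001 : binVec A 1 ![true, false, false, true] ![false, false, false, false] u ∈ valModS A 0 ↑(famB1S A P u₁ u₂ Q w u₀) :=
      memT A (memS A y9) c0110
    have c0001 : binVec A 1 ![false, false, false, true] ![false, false, false, false] u ∈ valModS A 0 ↑(famB1S A P u₁ u₂ Q w u₀) :=
      memT A m5 c1001
    have c1101 : binVec A 1 ![true, true, false, true] ![false, false, false, false] u ∈ valModS A 0 ↑(famB1S A P u₁ u₂ Q w u₀) :=
      memT A (memJ A _ (a := ![true, true, false, true]) (b := ![true, false, false, true]) (by decide) u) c1001
    have c0101 : binVec A 1 ![false, true, false, true] ![false, false, false, false] u ∈ valModS A 0 ↑(famB1S A P u₁ u₂ Q w u₀) :=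
      memT A (memJ A _ (a := ![false, true, false, true]) (b := ![false, false, false, true]) (by decide) u) c0001
    cases a0 <;> cases a1 <;> cases a2 <;> cases a3
    exacts [c0000, c0001, c0010, c0011, c0100, c0101, c0110, c0111, c1000, c1001, c1010, c1011, c1100, c1101, c1110, c1111]
  exact key _ _ _ _

/-- **Every slot binomial of coordinate `1` lies in the value module of `B1`.** [folklore] -/
theorem all_oneS (hA : Odd (Fintype.card A)) (h3 : 3 ≤ Fintype.card A) (h1 : u₁ ∉ P) (h2 : u₂ ∉ P) (h12 : u₁ ≠ u₂)
    (hP : P.card + 1 = Fintype.card A / 2) (hs₀ : s₀ ∈ insert u₁ (insert u₂ P))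
    (hX : ∀ s, s + σ ∈ insert u₁ (insert u₂ P) ↔ (s ∉ insert u₁ (insert u₂ P) ∨ s = s₀)) (hw : w ∉ Q)
    (hQ : Q.card = Fintype.card A / 2) (h h' : Fin 4 → Bool) (u : A) :
    binVec A 1 h h' u ∈ valModS A 0 ↑(famB1S A P u₁ u₂ Q w u₀) :=
  memT A (toRoot_oneS A hA h3 h1 h2 h12 hP hs₀ hX hw hQ h u) (memS A (toRoot_oneS A hA h3 h1 h2 h12 hP hs₀ hX hw hQ h' u))

/-! ## §4 Every slot binomial of every coordinate -/

omit [AddCommGroup A] [Fintype A] [DecidableEq A] in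
/-- `qS` after complementing twice recovers the pattern: `qS (¬ qS (¬ g)) = g`. [folklore] -/
theorem qS_not_qS_not (g : Fin 4 → Bool) : qS (fun n => !(qS (fun m => !g m)) n) = g := by
  funext n; fin_cases n <;> simp [qS, bS, σT]

/-- **EVERY slot binomial lies in the value module of `B1`** (coordinate `1` by the trees; `0 = σY 1` and `2 = σY 3` by the unmasked motion of `y`
at square class `0`; `3 = σT 1` by the MASKED motion of `s`, whose pattern map is still a bijection). [folklore] -/
theorem all_binS (hA : Odd (Fintype.card A)) (h3 : 3 ≤ Fintype.card A) (h1 : u₁ ∉ P) (h2 : u₂ ∉ P) (h12 : u₁ ≠ u₂)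
    (hP : P.card + 1 = Fintype.card A / 2) (hs₀ : s₀ ∈ insert u₁ (insert u₂ P))
    (hX : ∀ s, s + σ ∈ insert u₁ (insert u₂ P) ↔ (s ∉ insert u₁ (insert u₂ P) ∨ s = s₀)) (hw : w ∉ Q)
    (hQ : Q.card = Fintype.card A / 2) (j : Fin 4) (g g' : Fin 4 → Bool) (u : A) :
    binVec A j g g' u ∈ valModS A 0 ↑(famB1S A P u₁ u₂ Q w u₀) := by
  have H1 := all_oneS A hA h3 h1 h2 h12 hP hs₀ hX hw hQ (u₀ := u₀)
  have H0 : ∀ (g g' : Fin 4 → Bool) (u : A), binVec A 0 g g' u ∈ valModS A 0 ↑(famB1S A P u₁ u₂ Q w u₀) := fun g g' u =>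
    Y_memS A hA (j := 1) (by decide) (by decide) (qY_pY 0 g) (qY_pY 0 g') (H1 (pY 0 g) (pY 0 g') u) u
  have H3 : ∀ (g g' : Fin 4 → Bool) (u : A), binVec A 3 g g' u ∈ valModS A 0 ↑(famB1S A P u₁ u₂ Q w u₀) := fun g g' u =>
    S_mem' A hA (j := 1) (by decide) (by decide) (qS_not_qS_not g) (qS_not_qS_not g')
      (H1 (qS fun m => !g' m) (qS fun m => !g m) u) u
  have H2 : ∀ (g g' : Fin 4 → Bool) (u : A), binVec A 2 g g' u ∈ valModS A 0 ↑(famB1S A P u₁ u₂ Q w u₀) := fun g g' u =>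
    Y_memS A hA (j := 3) (by decide) (by decide) (qY_pY 0 g) (qY_pY 0 g') (H3 (pY 0 g) (pY 0 g') u) u
  fin_cases j
  · exact H0 g g' u
  · exact H1 g g' u
  · exact H2 g g' u
  · exact H3 g g' u

end Trees

end

end Summit.HodgeConjecture.CorCM.Census.ShearedDihedral
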